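/-
Copyright (c) 2026 the pub-hodgecm-mathlib formalisation cell (harness21).  Prover seat hodgecm-mathlib-K2Liu-p13 (g0), Track B «K2-LIT»,
#184♮ = hLiu418 = `stmt-HodgeConjecture-24832`; Road I v3 organ U1-CT-ind STAGE 2 (Q2), file F4-1d (LEAD F0P6-plan (g13) 09:57:20Z «GO (Q2) F4 → F5 → D-U1 stage 3»).
-/
import Summits.HodgeConjecture.HodgeConjecture.Theorems.K2LiuKlingenRationalCells   -- ★∕📤 F4-1c: `mk_transport_siegelFour_mul`, `transport_toAdelic_mul`
import HarnessLib

/-!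
# Crux `HLiu418`, Road I v3, organ U1 stage 2 (Q2), file F4-1d: `Q` CONJUGATES `N_Q` INTO THE SIEGEL PARABOLIC — `q · n_Q(y,z,t) · q⁻¹ ∈ P` for `q ∈ Q`,
# so the identity-cell classes `⟦Ψ(toAdelic q)⟧` of `P_Δ(L⁺)\H(L⁺)` are FIXED by `N_Q(L⁺)` (the identity cell of the Q-constant term is `vol · Σ_{cell 1} f`)

Cell `hodgecm-mathlib`, crux item hLiu418 = `stmt-HodgeConjecture-24832`; squad K2 ∕ K2Liu; LEAD F0P6-plan (g13), co-dealer K2E5-plan (g7); prover K2Liu-p13 (g0).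
THEOREMS ONLY (no `def`, no instance, no notation, no named-fact hypothesis, no `sorry`); lane `--supports stmt-HodgeConjecture-24832 --as helper` (count-neutral).
* §1 (generic `R`, `σ` involutive) THE LAST ROW OF A KLINGEN ELEMENT: `q ∈ Q = Stab(R e₀)` (`q₁₀ = q₂₀ = q₃₀ = 0`) has `q₃₀ = q₃₁ = q₃₂ = 0` and `σ(q₃₃) q₀₀ = 1` — unitarity read on the
  first column (`row_three_of_mem_klingen`): `Q` also stabilises `e₀^⊥ = ⟨e₀, e₁, e₂⟩`.
* §2 **`conj_nKlingen_mem_siegelFour`**: `q · n_Q(y,z,t) · q⁻¹ ∈ P` (`= siegelFour`) for `q ∈ Q` — the four lower-left entries vanish by §1 for `q` and `q⁻¹`, the shape of `n_Q`,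
  and `(q q⁻¹)₂₁ = 0`; hence `conj_mem_siegelFour_of_mem_klingenUnip`.  (The sharper `q N_Q q⁻¹ = N_Q` is not needed by the unfolding.)
* §3 (`n = 2`, through `Ψ ∘ toAdelic`, clauses of ★ F3 by value) **`mk_transport_klingen_mul_nKlingen`**: `⟦Ψ(toAdelic (q · n))⟧ = ⟦Ψ(toAdelic q)⟧` in `SiegelDeltaQuot` for
  `q ∈ Q(L⁺)`, `n ∈ N_Q(L⁺)` — the right `N_Q(L⁺)`-action fixes every identity-cell class (📤 F4-1c `mk_transport_siegelFour_mul`).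
[Xiong2013 §4 Prop. 4.1, §7 L. 7.1], [MoeglinWaldspurger1995 I.2.1, II.1.7], [Casselman1980 §3].
HONEST LABEL.  Count-neutral helper: `HC_CM` is proved only modulo the 7 printed citations (2 remaining named inputs: hLiu418 = `stmt-HodgeConjecture-24832`,
h413 = `stmt-HodgeConjecture-24833`) until rung 0 closes.
-/

set_option autoImplicit false
set_option linter.dupNamespace false -- the mandated namespace repeats `HodgeConjecture.HodgeConjecture`

noncomputable section

open scoped Matrix
open NumberField IsDedekindDomain

namespace Summit.HodgeConjecture.HodgeConjecture.Cruxes.HLiu418.K2LiuKlingenConjUnipotent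

open Literature.NumberTheory.Automorphic Literature.NumberTheory.Automorphic.UnitaryGroup
open Literature.NumberTheory.GelbartRogawski1991 Literature.NumberTheory.GelbartRogawski1991.GRConstruction
open Literature.NumberTheory.GaloisRepresentations
open Literature.NumberTheory.K2Lit.SiegelDoubled
open Summit.HodgeConjecture.HodgeConjecture.Cruxes.HLiu418.K2LiuDoubledUTwoTwoBorelFrame
open Summit.HodgeConjecture.HodgeConjecture.Cruxes.HLiu418.K2LiuKlingenParabolicDefs
open Summit.HodgeConjecture.HodgeConjecture.Cruxes.HLiu418.K2LiuKlingenUnipotentDefs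
open Summit.HodgeConjecture.HodgeConjecture.Cruxes.HLiu418.K2LiuKlingenRationalCells
open UnitaryDualPair

/-! ## §1 The last row of a Klingen element -/

section Generic

variable {R : Type*} [CommRing R] {σ : R →+* R}

/-- **unitarity on the first column of `q ∈ Q`**: `σ(q₃ᵢ)·q₀₀ = J_{i0}` for the antidiagonal `J` (`i = 1, 2, 3`). [cite: Casselman1980, §3] -/
theorem col_zero_unitarity_of_mem_klingen {q : unitaryGroupOfForm σ ((StdForm.antidiagonal 4).over R)} (hq : q ∈ klingen R σ) :
    σ (((q : GL (Fin 4) R) : Matrix (Fin 4) (Fin 4) R) 3 1) * ((q : GL (Fin 4) R) : Matrix (Fin 4) (Fin 4) R) 0 0 = 0 ∧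
      σ (((q : GL (Fin 4) R) : Matrix (Fin 4) (Fin 4) R) 3 2) * ((q : GL (Fin 4) R) : Matrix (Fin 4) (Fin 4) R) 0 0 = 0 ∧
      σ (((q : GL (Fin 4) R) : Matrix (Fin 4) (Fin 4) R) 3 3) * ((q : GL (Fin 4) R) : Matrix (Fin 4) (Fin 4) R) 0 0 = 1 := by
  obtain ⟨h10, h20, h30⟩ := hq
  have h := mem_unitaryGroupOfForm_iff.1 q.2
  have e1 : σ (((q : GL (Fin 4) R) : Matrix (Fin 4) (Fin 4) R) 3 1) * ((q : GL (Fin 4) R) : Matrix (Fin 4) (Fin 4) R) 0 0 = 0 := by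
    simpa [antidiagonal_over_four, antidiagFour, Matrix.mul_apply, Fin.sum_univ_four, h10, h20, h30] using congrFun (congrFun h 1) 0
  have e2 : σ (((q : GL (Fin 4) R) : Matrix (Fin 4) (Fin 4) R) 3 2) * ((q : GL (Fin 4) R) : Matrix (Fin 4) (Fin 4) R) 0 0 = 0 := by
    simpa [antidiagonal_over_four, antidiagFour, Matrix.mul_apply, Fin.sum_univ_four, h10, h20, h30] using congrFun (congrFun h 2) 0
  have e3 : σ (((q : GL (Fin 4) R) : Matrix (Fin 4) (Fin 4) R) 3 3) * ((q : GL (Fin 4) R) : Matrix (Fin 4) (Fin 4) R) 0 0 = 1 := by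
    simpa [antidiagonal_over_four, antidiagFour, Matrix.mul_apply, Fin.sum_univ_four, h10, h20, h30] using congrFun (congrFun h 3) 0
  exact ⟨e1, e2, e3⟩

/-- **the last row of `q ∈ Q` is `(0, 0, 0, q₃₃)`**: `Q` stabilises `e₀^⊥ = ⟨e₀,e₁,e₂⟩` (`σ` involutive). [cite: Casselman1980, §3] [cite: MoeglinWaldspurger1995, I.2.1] -/
theorem row_three_of_mem_klingen (hσ : ∀ x, σ (σ x) = x) {q : unitaryGroupOfForm σ ((StdForm.antidiagonal 4).over R)} (hq : q ∈ klingen R σ) :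
    ((q : GL (Fin 4) R) : Matrix (Fin 4) (Fin 4) R) 3 0 = 0 ∧ ((q : GL (Fin 4) R) : Matrix (Fin 4) (Fin 4) R) 3 1 = 0 ∧
      ((q : GL (Fin 4) R) : Matrix (Fin 4) (Fin 4) R) 3 2 = 0 := by
  obtain ⟨e1, e2, e3⟩ := col_zero_unitarity_of_mem_klingen hq
  -- `q₀₀ σ(q₃₃) = 1`, so `σ(q₃ᵢ) = σ(q₃ᵢ) · q₀₀ · σ(q₃₃) = 0`, hence `q₃ᵢ = σ(σ(q₃ᵢ)) = 0`
  have key : ∀ x : R, σ x * ((q : GL (Fin 4) R) : Matrix (Fin 4) (Fin 4) R) 0 0 = 0 → x = 0 := fun x hx => by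
    have h1 : σ x = σ x * (σ (((q : GL (Fin 4) R) : Matrix (Fin 4) (Fin 4) R) 3 3) * ((q : GL (Fin 4) R) : Matrix (Fin 4) (Fin 4) R) 0 0) := by
      rw [e3, mul_one]
    rw [mul_comm (σ _) (((q : GL (Fin 4) R) : Matrix (Fin 4) (Fin 4) R) 0 0), ← mul_assoc, hx, zero_mul] at h1
    rw [← hσ x, h1, map_zero]
  exact ⟨hq.2.2, key _ e1, key _ e2⟩

/-! ## §2 `q · n_Q · q⁻¹ ∈ P` for `q ∈ Q` -/

/-- **`Q` CONJUGATES `N_Q` INTO THE SIEGEL PARABOLIC**: `q · n_Q(y,z,t) · q⁻¹ ∈ siegelFour` for `q ∈ klingen`. [cite: Xiong2013, §4 Prop. 4.1] [cite: MoeglinWaldspurger1995, I.2.1] -/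
theorem conj_nKlingen_mem_siegelFour (hσ : ∀ x, σ (σ x) = x) {q : unitaryGroupOfForm σ ((StdForm.antidiagonal 4).over R)} (hq : q ∈ klingen R σ)
    (y : R) (hy : σ y = -y) (z t : R) :
    q * nKlingen R σ hσ y hy z t * q⁻¹ ∈ siegelFour R σ := by
  have hqi : q⁻¹ ∈ klingen R σ := (klingen R σ).inv_mem hq
  obtain ⟨hq30, hq31, hq32⟩ := row_three_of_mem_klingen hσ hq
  obtain ⟨-, hi31, -⟩ := row_three_of_mem_klingen hσ hqi
  obtain ⟨-, hq20, -⟩ := hq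
  obtain ⟨hi10, hi20, hi30⟩ := hqi
  -- `(q q⁻¹)₂₁ = 0`
  have hqq : ((q : GL (Fin 4) R) : Matrix (Fin 4) (Fin 4) R) * (((q⁻¹ : unitaryGroupOfForm σ ((StdForm.antidiagonal 4).over R)) : GL (Fin 4) R) :
      Matrix (Fin 4) (Fin 4) R) = 1 := by
    rw [← Units.val_mul, ← Subgroup.coe_mul, mul_inv_cancel, Subgroup.coe_one, Units.val_one]
  have h21 : ((q : GL (Fin 4) R) : Matrix (Fin 4) (Fin 4) R) 2 1 * (((q⁻¹ : unitaryGroupOfForm σ ((StdForm.antidiagonal 4).over R)) : GL (Fin 4) R) :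
        Matrix (Fin 4) (Fin 4) R) 1 1 +
      ((q : GL (Fin 4) R) : Matrix (Fin 4) (Fin 4) R) 2 2 * (((q⁻¹ : unitaryGroupOfForm σ ((StdForm.antidiagonal 4).over R)) : GL (Fin 4) R) :
        Matrix (Fin 4) (Fin 4) R) 2 1 = 0 := by
    have := congrFun (congrFun hqq 2) 1
    simp only [Matrix.mul_apply, Fin.sum_univ_four, hq20, hi31, zero_mul, mul_zero, add_zero, zero_add,
      Matrix.one_apply_ne (by decide : (2 : Fin 4) ≠ 1)] at this
    exact this
  refine ⟨?_, ?_, ?_, ?_⟩ <;>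
    simp only [Subgroup.coe_mul, Units.val_mul, coe_nKlingen, Matrix.mul_apply, Fin.sum_univ_four, nKlingenM, Matrix.of_apply, Matrix.cons_val',
      Matrix.cons_val_zero, Matrix.cons_val_one, Matrix.cons_val, Matrix.empty_val', Matrix.cons_val_fin_one, hq20, hq30, hq31, hq32, hi10, hi20, hi30, hi31,
      mul_zero, zero_mul, add_zero, zero_add, mul_one]
  -- the `(2,1)` entry: `q₂₁ N₁₁ + q₂₂ N₂₁`
  linear_combination h21

/-- `q · n · q⁻¹ ∈ P` for `q ∈ Q`, `n ∈ N_Q`. [cite: Xiong2013, §4 Prop. 4.1] [cite: MoeglinWaldspurger1995, I.2.1] -/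
theorem conj_mem_siegelFour_of_mem_klingenUnip (hσ : ∀ x, σ (σ x) = x) {q n : unitaryGroupOfForm σ ((StdForm.antidiagonal 4).over R)}
    (hq : q ∈ klingen R σ) (hn : n ∈ klingenUnip R σ hσ) : q * n * q⁻¹ ∈ siegelFour R σ := by
  obtain ⟨y, hy, z, t, rfl⟩ := hn
  exact conj_nKlingen_mem_siegelFour hσ hq y hy z t

end Generic

/-! ## §3 The identity-cell classes are fixed by `N_Q(L⁺)` (`n = 2`) -/

variable {L : Type} [Field L] [NumberField L] [IsCMField L]
variable {N M : ℕ} {e : Fin N × Fin M ≃ Fin 2}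
  {dV : Fin N → L} {hdV : ∀ i, IsCMField.complexConj L (dV i) = dV i}
  {dW : Fin M → L} {hdW : ∀ i, IsCMField.complexConj L (dW i) = dW i}

/-- **`⟦Ψ(toAdelic (q·n))⟧ = ⟦Ψ(toAdelic q)⟧` in `P_Δ(L⁺)\H(L⁺)`** for `q ∈ Q(L⁺)`, `n ∈ N_Q(L⁺)`: `q n = (q n q⁻¹) q` with `q n q⁻¹ ∈ P(L⁺)`, invisible by 📤 F4-1c
`mk_transport_siegelFour_mul`.  The right `N_Q(L⁺)`-action fixes every class of the identity cell. [cite: Xiong2013, §4 Prop. 4.1] [cite: MoeglinWaldspurger1995, II.1.7] -/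
theorem mk_transport_klingen_mul_nKlingen {SA : GL (Fin (2 + 2)) (AdeleRing (𝓞 L) L)}
    {Ψ : (quasiSplit (Fp L) L (IsCMField.complexConj L) (2 + 2)).Adelic ≃ₜ* HA L e dV hdV dW hdW} {X Y : Matrix (Fin 2) (Fin 2) (Fp L)} {a : Fp L}
    (hΨ : ∀ g : (quasiSplit (Fp L) L (IsCMField.complexConj L) (2 + 2)).Adelic,
      (((Ψ g : HA L e dV hdV dW hdW) : GL (Fin (2 + 2)) (AdeleRing (𝓞 L) L)) : Matrix (Fin (2 + 2)) (Fin (2 + 2)) (AdeleRing (𝓞 L) L)) =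
        (SA : Matrix (Fin (2 + 2)) (Fin (2 + 2)) (AdeleRing (𝓞 L) L)) *
          ((adelicVal (Fp L) L (IsCMField.complexConj L) (2 + 2) _ g : GL (Fin (2 + 2)) (AdeleRing (𝓞 L) L)) :
            Matrix (Fin (2 + 2)) (Fin (2 + 2)) (AdeleRing (𝓞 L) L)) *
          ((SA⁻¹ : GL (Fin (2 + 2)) (AdeleRing (𝓞 L) L)) : Matrix (Fin (2 + 2)) (Fin (2 + 2)) (AdeleRing (𝓞 L) L)))
    (ha : a + a = 1)
    (hSA : Matrix.reindex (e₂ (n := 2)).symm (e₂ (n := 2)).symm (SA : Matrix (Fin (2 + 2)) (Fin (2 + 2)) (AdeleRing (𝓞 L) L)) =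
      Matrix.fromBlocks (1 : Matrix (Fin 2) (Fin 2) (AdeleRing (𝓞 L) L)) (X.map ((algebraMap L (AdeleRing (𝓞 L) L)).comp (algebraMap (Fp L) L))) 1
        (-(X.map ((algebraMap L (AdeleRing (𝓞 L) L)).comp (algebraMap (Fp L) L)))))
    (hSAi : Matrix.reindex (e₂ (n := 2)).symm (e₂ (n := 2)).symm ((SA⁻¹ : GL (Fin (2 + 2)) (AdeleRing (𝓞 L) L)) : Matrix (Fin (2 + 2)) (Fin (2 + 2)) (AdeleRing (𝓞 L) L)) =
      Matrix.fromBlocks ((a • (1 : Matrix (Fin 2) (Fin 2) (Fp L))).map ((algebraMap L (AdeleRing (𝓞 L) L)).comp (algebraMap (Fp L) L)))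
        ((a • (1 : Matrix (Fin 2) (Fin 2) (Fp L))).map ((algebraMap L (AdeleRing (𝓞 L) L)).comp (algebraMap (Fp L) L)))
        (Y.map ((algebraMap L (AdeleRing (𝓞 L) L)).comp (algebraMap (Fp L) L)))
        (-(Y.map ((algebraMap L (AdeleRing (𝓞 L) L)).comp (algebraMap (Fp L) L)))))
    (hXY : X * Y = a • (1 : Matrix (Fin 2) (Fin 2) (Fp L))) (hYX : Y * X = a • (1 : Matrix (Fin 2) (Fin 2) (Fp L)))
    {q n : unitaryGroupOfForm ((IsCMField.complexConj L : L ≃ₐ[Fp L] L) : L →+* L) ((StdForm.antidiagonal 4).over L)}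
    (hq : q ∈ klingen L ((IsCMField.complexConj L : L ≃ₐ[Fp L] L) : L →+* L))
    (hn : n ∈ klingenUnip L ((IsCMField.complexConj L : L ≃ₐ[Fp L] L) : L →+* L) (complexConj_ringHom_apply_apply L)) :
    (Quotient.mk (MulAction.orbitRel (siegelDeltaRat L e dV hdV dW hdW) (ratH L e dV hdV dW hdW))
        ⟨Ψ (UnitaryGroup.toAdelic (Fp L) L (IsCMField.complexConj L) (2 + 2) ((StdForm.antidiagonal (2 + 2)).over L)
            (q * n : unitaryGroupOfForm ((IsCMField.complexConj L : L ≃ₐ[Fp L] L) : L →+* L) ((StdForm.antidiagonal 4).over L))),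
          transport_toAdelic_mem_ratH hΨ ha hSA hSAi hXY hYX _⟩ : SiegelDeltaQuot L e dV hdV dW hdW) =
      Quotient.mk _ ⟨Ψ (UnitaryGroup.toAdelic (Fp L) L (IsCMField.complexConj L) (2 + 2) ((StdForm.antidiagonal (2 + 2)).over L) q),
          transport_toAdelic_mem_ratH hΨ ha hSA hSAi hXY hYX q⟩ := by
  have hfac : (q * n : unitaryGroupOfForm ((IsCMField.complexConj L : L ≃ₐ[Fp L] L) : L →+* L) ((StdForm.antidiagonal 4).over L)) = q * n * q⁻¹ * q := by
    rw [inv_mul_cancel_right]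
  have hγ : (⟨Ψ (UnitaryGroup.toAdelic (Fp L) L (IsCMField.complexConj L) (2 + 2) ((StdForm.antidiagonal (2 + 2)).over L)
            (q * n : unitaryGroupOfForm ((IsCMField.complexConj L : L ≃ₐ[Fp L] L) : L →+* L) ((StdForm.antidiagonal 4).over L))),
          transport_toAdelic_mem_ratH hΨ ha hSA hSAi hXY hYX _⟩ : ratH L e dV hdV dW hdW) =
      ⟨Ψ (UnitaryGroup.toAdelic (Fp L) L (IsCMField.complexConj L) (2 + 2) ((StdForm.antidiagonal (2 + 2)).over L) (q * n * q⁻¹)),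
          transport_toAdelic_mem_ratH hΨ ha hSA hSAi hXY hYX _⟩ *
        ⟨Ψ (UnitaryGroup.toAdelic (Fp L) L (IsCMField.complexConj L) (2 + 2) ((StdForm.antidiagonal (2 + 2)).over L) q),
          transport_toAdelic_mem_ratH hΨ ha hSA hSAi hXY hYX q⟩ := by
    refine Subtype.ext ?_
    show Ψ (UnitaryGroup.toAdelic (Fp L) L (IsCMField.complexConj L) (2 + 2) ((StdForm.antidiagonal (2 + 2)).over L)
        (q * n : unitaryGroupOfForm ((IsCMField.complexConj L : L ≃ₐ[Fp L] L) : L →+* L) ((StdForm.antidiagonal 4).over L))) =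
      Ψ (UnitaryGroup.toAdelic (Fp L) L (IsCMField.complexConj L) (2 + 2) ((StdForm.antidiagonal (2 + 2)).over L) (q * n * q⁻¹)) *
        Ψ (UnitaryGroup.toAdelic (Fp L) L (IsCMField.complexConj L) (2 + 2) ((StdForm.antidiagonal (2 + 2)).over L) q)
    rw [← transport_toAdelic_mul, ← hfac]
  rw [hγ]
  exact mk_transport_siegelFour_mul hΨ ha hSA hSAi hXY hYX (conj_mem_siegelFour_of_mem_klingenUnip _ hq hn) _

end Summit.HodgeConjecture.HodgeConjecture.Cruxes.HLiu418.K2LiuKlingenConjUnipotent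

end
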